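import Summits.CriticalPhenomena.PercolationContinuityZ3.Theorems.PercNearOneGluingNoHeavyQuantLongTailTripleHubAlg
import HarnessLib

/-!
# QUANT lane R8, T-DEC: ALGEBRA OF THE LONG-TAIL QUAD HUB, CERTIFICATES — the two closed forms of the route `4lo → 4lo+3K` of the width-4
# sub-floor hub `S(γ₁) ∗ S(γ₂) ∗ S(γ₃) ∗ S(γ₄)` of shape `{lo, lo+K; γ}`, `2lo ≤ K ≤ 4lo` (census-1 gen 35)

builds on p205010 (kernel theorem, internal audit signed; external expert review pending)

Support file (`--supports stmt-CriticalPhenomena-4575`), QUANT lane seat prim-quant-census-1 (gen 35); memo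
`run/shared/lean/prim/quant/prim-quant-census-1/g35/QUADHUB-G35.md`.  Theorems only, standard axioms, no sorries.  Pure real-polynomial
inequalities in K-UNITS (notation of `…QuantLongTailQuadHubAlg`: gates `gᵢ ∈ [c,1]`, `c = lo/K ≥ 1/4`, `Λ = Σgᵢ`, masses `u₀..u₃`), at the worst
credit `d = Λ − 4c` of the regime `d ≥ 1` (the monotone reduction to every `d` is in `…QuantLongTailQuadHubAlgK`):
* `quadHub_coreC` — floor part: `(Λ+4c)·u₀ ≤ (4−Λ)·u₃` (so `y(u₀+u₃) ≤ u₃` for every floor with `4y(1+c) ≤ 8c+d`);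
* `quadHub_coreD` — credit part: `(Λ−4c)·u₀ ≤ (3−Λ+4c)·u₃` (so `(d/3)(u₀+u₃) ≤ u₃`).
Both are degree-5 HANDELMAN CERTIFICATES — nonnegative combinations of products of the box atoms `gᵢ − c`, `1 − gᵢ`, `c − 1/4` and the regime atom
`Λ − 4c − 1` (113 and 139 products; found by kit j307101 = `g35/code/kitjob1`: scipy/HiGHS float LP for the support + exact rational Gaussian
repair, identity re-verified in exact arithmetic) — checked here by `linarith`.  Both have large margins (≥ 68 % on the census grids); no hand proof
was sought.
NUMERICS (memo §1): 0 failures on exact gate grids for `c ∈ {1/4, …, 1/2}` (`g35/code/exp1_quad_ineqs.py`).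

HONEST STATUS.  Algebra only; `SiblingStep`, `GluedDominatedMass`, `SDECConvClosed`, `FarTreeRow` OPEN; RATE class (log\*) / honest sentence of
`run/shared/lean/prim/quant/README.md` unchanged.  [this work].  Nothing here is cited as a published result.  The gluing rows served
[cite: KozmaNitzan2024, Conjecture 3 (p. 15)]; product measure [cite: Grimmett1999, §1.3 p. 10].
-/

noncomputable section

namespace Summit.CriticalPhenomena.PercolationContinuityZ3.Theorems
namespace Quant
namespace LawDec

set_option maxRecDepth 8192 in
set_option maxHeartbeats 4000000 in
/-- **core (C′)**: `(Λ+4c)·u₀ ≤ (4−Λ)·u₃` for gates in `[c,1]`, `c ≥ 1/4`, `Λ ≥ 4c+1` (floor capacity of `4lo → 4lo+3K` at the worst credit `d = Λ−4c`). Degree-5 Handelman certificate, 113 products (kit j307101), checked by `linarith`. [this work] -/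
theorem quadHub_coreC (g₁ g₂ g₃ g₄ c : ℝ) (hc : 1 / 4 ≤ c) (h1 : c ≤ g₁) (h2 : c ≤ g₂) (h3 : c ≤ g₃) (h4 : c ≤ g₄) (h11 : g₁ ≤ 1) (h21 : g₂ ≤ 1) (h31 : g₃ ≤ 1) (h41 : g₄ ≤ 1) (hS : 4 * c + 1 ≤ g₁ + g₂ + g₃ + g₄) :
    (g₁ + g₂ + g₃ + g₄ + 4 * c) * ((1 - g₁) * (1 - g₂) * (1 - g₃) * (1 - g₄))
      ≤ (4 - (g₁ + g₂ + g₃ + g₄)) * (g₂ * g₃ * g₄ * (1 - g₁) + g₁ * g₃ * g₄ * (1 - g₂) + g₁ * g₂ * g₄ * (1 - g₃) + g₁ * g₂ * g₃ * (1 - g₄)) := by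
  have a1 : 0 ≤ g₁ - c := sub_nonneg.2 h1
  have a2 : 0 ≤ g₂ - c := sub_nonneg.2 h2
  have a3 : 0 ≤ g₃ - c := sub_nonneg.2 h3
  have a4 : 0 ≤ g₄ - c := sub_nonneg.2 h4
  have e1 : 0 ≤ 1 - g₁ := sub_nonneg.2 h11
  have e2 : 0 ≤ 1 - g₂ := sub_nonneg.2 h21
  have e3 : 0 ≤ 1 - g₃ := sub_nonneg.2 h31
  have e4 : 0 ≤ 1 - g₄ := sub_nonneg.2 h41
  have bl : 0 ≤ c - (1/4 : ℝ) := by linarith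
  have s1 : 0 ≤ g₁ + g₂ + g₃ + g₄ - 4 * c - 1 := by linarith
  linarith [mul_nonneg (mul_nonneg e4 e4) bl,
    mul_nonneg (mul_nonneg (mul_nonneg e4 e4) bl) s1,
    mul_nonneg (mul_nonneg (mul_nonneg (mul_nonneg e4 e4) bl) bl) s1,
    mul_nonneg (mul_nonneg (mul_nonneg e4 e4) e4) bl,
    mul_nonneg (mul_nonneg (mul_nonneg (mul_nonneg e4 e4) e4) bl) bl,
    mul_nonneg (mul_nonneg (mul_nonneg e3 e4) bl) s1,
    mul_nonneg (mul_nonneg (mul_nonneg e3 e4) bl) bl,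
    mul_nonneg (mul_nonneg e3 e3) bl,
    mul_nonneg (mul_nonneg (mul_nonneg e3 e3) bl) s1,
    mul_nonneg (mul_nonneg (mul_nonneg (mul_nonneg e3 e3) bl) bl) s1,
    mul_nonneg (mul_nonneg (mul_nonneg e3 e3) e3) bl,
    mul_nonneg (mul_nonneg (mul_nonneg (mul_nonneg e3 e3) e3) bl) bl,
    mul_nonneg (mul_nonneg e2 e4) s1,
    mul_nonneg (mul_nonneg (mul_nonneg e2 e4) bl) s1,
    mul_nonneg (mul_nonneg (mul_nonneg e2 e4) bl) bl,
    mul_nonneg (mul_nonneg (mul_nonneg e2 e3) bl) s1,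
    mul_nonneg (mul_nonneg (mul_nonneg e2 e3) bl) bl,
    mul_nonneg (mul_nonneg (mul_nonneg (mul_nonneg e2 e3) e4) e4) bl,
    mul_nonneg (mul_nonneg (mul_nonneg (mul_nonneg e2 e3) e3) e4) bl,
    mul_nonneg (mul_nonneg e2 e2) bl,
    mul_nonneg (mul_nonneg (mul_nonneg e2 e2) bl) s1,
    mul_nonneg (mul_nonneg (mul_nonneg (mul_nonneg e2 e2) bl) bl) s1,
    mul_nonneg (mul_nonneg (mul_nonneg (mul_nonneg e2 e2) e3) e4) bl,
    mul_nonneg (mul_nonneg (mul_nonneg e2 e2) e2) bl,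
    mul_nonneg (mul_nonneg (mul_nonneg (mul_nonneg e2 e2) e2) bl) bl,
    mul_nonneg (mul_nonneg (mul_nonneg e1 e4) bl) s1,
    mul_nonneg (mul_nonneg (mul_nonneg e1 e4) bl) bl,
    mul_nonneg (mul_nonneg e1 e3) bl,
    mul_nonneg (mul_nonneg (mul_nonneg e1 e3) bl) s1,
    mul_nonneg (mul_nonneg (mul_nonneg e1 e3) bl) bl,
    mul_nonneg (mul_nonneg (mul_nonneg (mul_nonneg e1 e3) e4) e4) bl,
    mul_nonneg (mul_nonneg (mul_nonneg (mul_nonneg e1 e3) e3) e4) bl,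
    mul_nonneg (mul_nonneg (mul_nonneg e1 e2) bl) s1,
    mul_nonneg (mul_nonneg (mul_nonneg e1 e2) bl) bl,
    mul_nonneg (mul_nonneg (mul_nonneg (mul_nonneg e1 e2) e4) e4) bl,
    mul_nonneg (mul_nonneg (mul_nonneg (mul_nonneg e1 e2) e3) e4) s1,
    mul_nonneg (mul_nonneg (mul_nonneg (mul_nonneg e1 e2) e3) e3) bl,
    mul_nonneg (mul_nonneg (mul_nonneg (mul_nonneg e1 e2) e2) e4) bl,
    mul_nonneg (mul_nonneg (mul_nonneg (mul_nonneg e1 e2) e2) e3) bl,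
    mul_nonneg (mul_nonneg e1 e1) bl,
    mul_nonneg (mul_nonneg (mul_nonneg e1 e1) bl) s1,
    mul_nonneg (mul_nonneg (mul_nonneg (mul_nonneg e1 e1) bl) bl) s1,
    mul_nonneg (mul_nonneg (mul_nonneg (mul_nonneg e1 e1) e3) e4) bl,
    mul_nonneg (mul_nonneg (mul_nonneg (mul_nonneg e1 e1) e2) e4) bl,
    mul_nonneg (mul_nonneg (mul_nonneg (mul_nonneg e1 e1) e2) e3) bl,
    mul_nonneg (mul_nonneg (mul_nonneg e1 e1) e1) bl,
    mul_nonneg (mul_nonneg (mul_nonneg (mul_nonneg e1 e1) e1) bl) bl,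
    mul_nonneg (mul_nonneg (mul_nonneg a4 e2) e3) s1,
    mul_nonneg (mul_nonneg (mul_nonneg a4 e2) e3) bl,
    mul_nonneg (mul_nonneg (mul_nonneg a4 e1) e3) s1,
    mul_nonneg (mul_nonneg (mul_nonneg a4 e1) e2) s1,
    mul_nonneg (mul_nonneg (mul_nonneg (mul_nonneg a4 e1) e2) e3) e3,
    mul_nonneg (mul_nonneg (mul_nonneg (mul_nonneg a4 e1) e1) e2) e3,
    mul_nonneg (mul_nonneg (mul_nonneg a4 a4) e1) e3,
    mul_nonneg (mul_nonneg (mul_nonneg a3 e2) e4) bl,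
    mul_nonneg (mul_nonneg (mul_nonneg a3 e1) e4) s1,
    mul_nonneg (mul_nonneg (mul_nonneg a3 e1) e4) bl,
    mul_nonneg (mul_nonneg (mul_nonneg a3 e1) e2) s1,
    mul_nonneg (mul_nonneg (mul_nonneg a3 e1) e2) bl,
    mul_nonneg (mul_nonneg (mul_nonneg (mul_nonneg a3 e1) e2) e4) e4,
    mul_nonneg (mul_nonneg (mul_nonneg (mul_nonneg a3 e1) e2) e2) e4,
    mul_nonneg (mul_nonneg (mul_nonneg (mul_nonneg a3 e1) e1) e2) e4,
    mul_nonneg (mul_nonneg (mul_nonneg a3 a4) e2) e3,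
    mul_nonneg (mul_nonneg (mul_nonneg a3 a4) e2) e2,
    mul_nonneg (mul_nonneg (mul_nonneg (mul_nonneg a3 a4) e2) e2) bl,
    mul_nonneg (mul_nonneg (mul_nonneg a3 a4) e1) e4,
    mul_nonneg (mul_nonneg (mul_nonneg a3 a4) e1) e1,
    mul_nonneg (mul_nonneg (mul_nonneg (mul_nonneg a3 a4) e1) e1) bl,
    mul_nonneg (mul_nonneg (mul_nonneg a2 e3) e4) s1,
    mul_nonneg (mul_nonneg (mul_nonneg a2 e3) e4) bl,
    mul_nonneg (mul_nonneg (mul_nonneg a2 e1) e4) s1,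
    mul_nonneg (mul_nonneg (mul_nonneg a2 e1) e3) bl,
    mul_nonneg (mul_nonneg (mul_nonneg (mul_nonneg a2 e1) e3) e3) e4,
    mul_nonneg (mul_nonneg (mul_nonneg (mul_nonneg a2 e1) e1) e3) e4,
    mul_nonneg (mul_nonneg (mul_nonneg a2 a4) e3) e4,
    mul_nonneg (mul_nonneg (mul_nonneg a2 a4) e3) e3,
    mul_nonneg (mul_nonneg (mul_nonneg (mul_nonneg a2 a4) e3) e3) bl,
    mul_nonneg (mul_nonneg (mul_nonneg a2 a4) e2) e3,
    mul_nonneg (mul_nonneg (mul_nonneg a2 a4) e1) e1,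
    mul_nonneg (mul_nonneg (mul_nonneg (mul_nonneg a2 a4) e1) e1) bl,
    mul_nonneg (mul_nonneg (mul_nonneg (mul_nonneg a2 a3) e4) e4) bl,
    mul_nonneg (mul_nonneg (mul_nonneg a2 a3) e1) e3,
    mul_nonneg (mul_nonneg (mul_nonneg a2 a3) e1) e2,
    mul_nonneg (mul_nonneg (mul_nonneg a2 a3) e1) e1,
    mul_nonneg (mul_nonneg (mul_nonneg (mul_nonneg a2 a3) e1) e1) bl,
    mul_nonneg (mul_nonneg (mul_nonneg (mul_nonneg a2 a3) a4) e1) e1,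
    mul_nonneg (mul_nonneg (mul_nonneg a2 a2) e1) e4,
    mul_nonneg (mul_nonneg (mul_nonneg a1 e3) e4) bl,
    mul_nonneg (mul_nonneg (mul_nonneg a1 e2) e4) s1,
    mul_nonneg (mul_nonneg (mul_nonneg a1 e2) e4) bl,
    mul_nonneg (mul_nonneg (mul_nonneg a1 e2) e3) s1,
    mul_nonneg (mul_nonneg (mul_nonneg (mul_nonneg a1 e2) e3) e4) e4,
    mul_nonneg (mul_nonneg (mul_nonneg (mul_nonneg a1 e2) e2) e3) e4,
    mul_nonneg (mul_nonneg (mul_nonneg a1 a4) e3) e4,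
    mul_nonneg (mul_nonneg (mul_nonneg a1 a4) e3) e3,
    mul_nonneg (mul_nonneg (mul_nonneg (mul_nonneg a1 a4) e3) e3) bl,
    mul_nonneg (mul_nonneg (mul_nonneg a1 a4) e2) e2,
    mul_nonneg (mul_nonneg (mul_nonneg (mul_nonneg a1 a4) e2) e2) bl,
    mul_nonneg (mul_nonneg (mul_nonneg a1 a3) e4) e4,
    mul_nonneg (mul_nonneg (mul_nonneg (mul_nonneg a1 a3) e4) e4) bl,
    mul_nonneg (mul_nonneg (mul_nonneg a1 a3) e3) e4,
    mul_nonneg (mul_nonneg (mul_nonneg a1 a3) e2) e2,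
    mul_nonneg (mul_nonneg (mul_nonneg (mul_nonneg a1 a3) e2) e2) bl,
    mul_nonneg (mul_nonneg (mul_nonneg a1 a3) e1) e4,
    mul_nonneg (mul_nonneg (mul_nonneg (mul_nonneg a1 a3) a4) e2) e2,
    mul_nonneg (mul_nonneg (mul_nonneg a1 a2) e4) e4,
    mul_nonneg (mul_nonneg (mul_nonneg (mul_nonneg a1 a2) e4) e4) bl,
    mul_nonneg (mul_nonneg (mul_nonneg a1 a2) e3) e3,
    mul_nonneg (mul_nonneg (mul_nonneg (mul_nonneg a1 a2) e3) e3) bl,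
    mul_nonneg (mul_nonneg (mul_nonneg a1 a2) e2) e3,
    mul_nonneg (mul_nonneg (mul_nonneg a1 a2) e1) e4,
    mul_nonneg (mul_nonneg (mul_nonneg (mul_nonneg a1 a2) a4) e3) e3,
    mul_nonneg (mul_nonneg (mul_nonneg (mul_nonneg a1 a2) a3) e4) e4]

set_option maxRecDepth 8192 in
set_option maxHeartbeats 4000000 in
/-- **core (D′)**: `(Λ−4c)·u₀ ≤ (3−Λ+4c)·u₃` for gates in `[c,1]`, `c ≥ 1/4`, `Λ ≥ 4c+1` (credit capacity of `4lo → 4lo+3K` at `d = Λ−4c`). Degree-5 Handelman certificate, 139 products (kit j307101). [this work] -/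
theorem quadHub_coreD (g₁ g₂ g₃ g₄ c : ℝ) (hc : 1 / 4 ≤ c) (h1 : c ≤ g₁) (h2 : c ≤ g₂) (h3 : c ≤ g₃) (h4 : c ≤ g₄) (h11 : g₁ ≤ 1) (h21 : g₂ ≤ 1) (h31 : g₃ ≤ 1) (h41 : g₄ ≤ 1) (hS : 4 * c + 1 ≤ g₁ + g₂ + g₃ + g₄) :
    (g₁ + g₂ + g₃ + g₄ - 4 * c) * ((1 - g₁) * (1 - g₂) * (1 - g₃) * (1 - g₄))
      ≤ (3 - (g₁ + g₂ + g₃ + g₄) + 4 * c) * (g₂ * g₃ * g₄ * (1 - g₁) + g₁ * g₃ * g₄ * (1 - g₂) + g₁ * g₂ * g₄ * (1 - g₃) + g₁ * g₂ * g₃ * (1 - g₄)) := by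
  have a1 : 0 ≤ g₁ - c := sub_nonneg.2 h1
  have a2 : 0 ≤ g₂ - c := sub_nonneg.2 h2
  have a3 : 0 ≤ g₃ - c := sub_nonneg.2 h3
  have a4 : 0 ≤ g₄ - c := sub_nonneg.2 h4
  have e1 : 0 ≤ 1 - g₁ := sub_nonneg.2 h11
  have e2 : 0 ≤ 1 - g₂ := sub_nonneg.2 h21
  have e3 : 0 ≤ 1 - g₃ := sub_nonneg.2 h31
  have e4 : 0 ≤ 1 - g₄ := sub_nonneg.2 h41
  have bl : 0 ≤ c - (1/4 : ℝ) := by linarith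
  have s1 : 0 ≤ g₁ + g₂ + g₃ + g₄ - 4 * c - 1 := by linarith
  linarith [mul_nonneg (mul_nonneg e4 bl) bl,
    mul_nonneg (mul_nonneg (mul_nonneg e4 bl) bl) s1,
    mul_nonneg (mul_nonneg (mul_nonneg (mul_nonneg e4 bl) bl) s1) s1,
    mul_nonneg (mul_nonneg (mul_nonneg (mul_nonneg e4 bl) bl) bl) bl,
    mul_nonneg (mul_nonneg e4 e4) bl,
    mul_nonneg (mul_nonneg (mul_nonneg e4 e4) bl) s1,
    mul_nonneg (mul_nonneg (mul_nonneg (mul_nonneg e4 e4) bl) bl) s1,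
    mul_nonneg (mul_nonneg (mul_nonneg (mul_nonneg e4 e4) e4) e4) bl,
    mul_nonneg (mul_nonneg e3 bl) bl,
    mul_nonneg (mul_nonneg (mul_nonneg e3 bl) bl) s1,
    mul_nonneg (mul_nonneg (mul_nonneg (mul_nonneg e3 bl) bl) s1) s1,
    mul_nonneg (mul_nonneg (mul_nonneg (mul_nonneg e3 bl) bl) bl) bl,
    mul_nonneg (mul_nonneg (mul_nonneg e3 e4) bl) s1,
    mul_nonneg (mul_nonneg e3 e3) bl,
    mul_nonneg (mul_nonneg (mul_nonneg e3 e3) bl) s1,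
    mul_nonneg (mul_nonneg (mul_nonneg (mul_nonneg e3 e3) bl) bl) s1,
    mul_nonneg (mul_nonneg (mul_nonneg (mul_nonneg e3 e3) e3) e3) bl,
    mul_nonneg (mul_nonneg e2 bl) bl,
    mul_nonneg (mul_nonneg (mul_nonneg e2 bl) bl) s1,
    mul_nonneg (mul_nonneg (mul_nonneg (mul_nonneg e2 bl) bl) s1) s1,
    mul_nonneg (mul_nonneg (mul_nonneg (mul_nonneg e2 bl) bl) bl) bl,
    mul_nonneg (mul_nonneg (mul_nonneg e2 e4) bl) s1,
    mul_nonneg (mul_nonneg (mul_nonneg e2 e3) bl) s1,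
    mul_nonneg (mul_nonneg (mul_nonneg e2 e3) e4) bl,
    mul_nonneg (mul_nonneg e2 e2) bl,
    mul_nonneg (mul_nonneg (mul_nonneg e2 e2) bl) s1,
    mul_nonneg (mul_nonneg (mul_nonneg (mul_nonneg e2 e2) bl) bl) s1,
    mul_nonneg (mul_nonneg (mul_nonneg (mul_nonneg e2 e2) e2) e2) bl,
    mul_nonneg (mul_nonneg e1 bl) bl,
    mul_nonneg (mul_nonneg (mul_nonneg e1 bl) bl) s1,
    mul_nonneg (mul_nonneg (mul_nonneg (mul_nonneg e1 bl) bl) s1) s1,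
    mul_nonneg (mul_nonneg (mul_nonneg (mul_nonneg e1 bl) bl) bl) bl,
    mul_nonneg (mul_nonneg (mul_nonneg e1 e4) bl) s1,
    mul_nonneg (mul_nonneg (mul_nonneg e1 e3) bl) s1,
    mul_nonneg (mul_nonneg e1 e3) e4,
    mul_nonneg (mul_nonneg (mul_nonneg e1 e3) e4) bl,
    mul_nonneg (mul_nonneg (mul_nonneg e1 e2) bl) s1,
    mul_nonneg (mul_nonneg (mul_nonneg (mul_nonneg e1 e2) bl) bl) s1,
    mul_nonneg (mul_nonneg (mul_nonneg e1 e2) e4) bl,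
    mul_nonneg (mul_nonneg e1 e2) e3,
    mul_nonneg (mul_nonneg (mul_nonneg e1 e2) e3) bl,
    mul_nonneg (mul_nonneg (mul_nonneg (mul_nonneg e1 e2) e3) e4) s1,
    mul_nonneg (mul_nonneg e1 e1) bl,
    mul_nonneg (mul_nonneg (mul_nonneg e1 e1) bl) s1,
    mul_nonneg (mul_nonneg (mul_nonneg (mul_nonneg e1 e1) bl) bl) s1,
    mul_nonneg (mul_nonneg (mul_nonneg (mul_nonneg e1 e1) e1) e1) bl,
    mul_nonneg (mul_nonneg a4 e3) e4,
    mul_nonneg (mul_nonneg (mul_nonneg a4 e3) e3) bl,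
    mul_nonneg (mul_nonneg a4 e2) bl,
    mul_nonneg (mul_nonneg a4 e2) e4,
    mul_nonneg (mul_nonneg (mul_nonneg a4 e2) e3) s1,
    mul_nonneg (mul_nonneg (mul_nonneg (mul_nonneg a4 e2) e3) bl) s1,
    mul_nonneg (mul_nonneg (mul_nonneg a4 e2) e2) bl,
    mul_nonneg (mul_nonneg a4 e1) e4,
    mul_nonneg (mul_nonneg (mul_nonneg a4 e1) e3) s1,
    mul_nonneg (mul_nonneg (mul_nonneg (mul_nonneg a4 e1) e3) bl) s1,
    mul_nonneg (mul_nonneg (mul_nonneg (mul_nonneg a4 e1) e2) bl) s1,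
    mul_nonneg (mul_nonneg (mul_nonneg (mul_nonneg a4 a4) a4) e4) bl,
    mul_nonneg (mul_nonneg a3 e4) bl,
    mul_nonneg (mul_nonneg (mul_nonneg a3 e4) e4) bl,
    mul_nonneg (mul_nonneg a3 e3) e4,
    mul_nonneg (mul_nonneg a3 e2) bl,
    mul_nonneg (mul_nonneg (mul_nonneg (mul_nonneg a3 e2) e4) bl) s1,
    mul_nonneg (mul_nonneg a3 e2) e3,
    mul_nonneg (mul_nonneg (mul_nonneg a3 e2) e2) bl,
    mul_nonneg (mul_nonneg a3 e1) bl,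
    mul_nonneg (mul_nonneg (mul_nonneg a3 e1) e4) s1,
    mul_nonneg (mul_nonneg (mul_nonneg (mul_nonneg a3 e1) e4) bl) s1,
    mul_nonneg (mul_nonneg a3 e1) e3,
    mul_nonneg (mul_nonneg (mul_nonneg a3 e1) e2) s1,
    mul_nonneg (mul_nonneg (mul_nonneg (mul_nonneg a3 e1) e2) bl) s1,
    mul_nonneg (mul_nonneg (mul_nonneg a3 e1) e2) e4,
    mul_nonneg (mul_nonneg (mul_nonneg a3 a4) e2) e2,
    mul_nonneg (mul_nonneg (mul_nonneg (mul_nonneg a3 a4) e2) e2) bl,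
    mul_nonneg (mul_nonneg (mul_nonneg a3 a4) e1) bl,
    mul_nonneg (mul_nonneg (mul_nonneg a3 a4) e1) e1,
    mul_nonneg (mul_nonneg (mul_nonneg (mul_nonneg a3 a4) e1) e1) bl,
    mul_nonneg (mul_nonneg (mul_nonneg (mul_nonneg a3 a3) a3) e3) bl,
    mul_nonneg (mul_nonneg (mul_nonneg a2 e4) e4) bl,
    mul_nonneg (mul_nonneg (mul_nonneg a2 e3) e4) s1,
    mul_nonneg (mul_nonneg (mul_nonneg a2 e3) e3) bl,
    mul_nonneg (mul_nonneg a2 e2) e4,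
    mul_nonneg (mul_nonneg a2 e2) e3,
    mul_nonneg (mul_nonneg a2 e1) bl,
    mul_nonneg (mul_nonneg (mul_nonneg a2 e1) e4) s1,
    mul_nonneg (mul_nonneg (mul_nonneg (mul_nonneg a2 e1) e4) bl) s1,
    mul_nonneg (mul_nonneg (mul_nonneg a2 e1) e3) e4,
    mul_nonneg (mul_nonneg a2 e1) e2,
    mul_nonneg (mul_nonneg (mul_nonneg a2 e1) e1) bl,
    mul_nonneg (mul_nonneg (mul_nonneg a2 a4) e3) bl,
    mul_nonneg (mul_nonneg (mul_nonneg a2 a4) e3) e3,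
    mul_nonneg (mul_nonneg (mul_nonneg (mul_nonneg a2 a4) e3) e3) bl,
    mul_nonneg (mul_nonneg (mul_nonneg a2 a4) e1) bl,
    mul_nonneg (mul_nonneg (mul_nonneg a2 a4) e1) e1,
    mul_nonneg (mul_nonneg (mul_nonneg (mul_nonneg a2 a4) e1) e1) bl,
    mul_nonneg (mul_nonneg (mul_nonneg a2 a3) e4) bl,
    mul_nonneg (mul_nonneg (mul_nonneg a2 a3) e4) e4,
    mul_nonneg (mul_nonneg (mul_nonneg (mul_nonneg a2 a3) e4) e4) bl,
    mul_nonneg (mul_nonneg (mul_nonneg (mul_nonneg a2 a3) e1) e4) s1,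
    mul_nonneg (mul_nonneg (mul_nonneg a2 a3) e1) e1,
    mul_nonneg (mul_nonneg (mul_nonneg (mul_nonneg a2 a3) e1) e1) bl,
    mul_nonneg (mul_nonneg (mul_nonneg (mul_nonneg a2 a3) a4) e1) bl,
    mul_nonneg (mul_nonneg (mul_nonneg (mul_nonneg a2 a3) a4) e1) e1,
    mul_nonneg (mul_nonneg (mul_nonneg (mul_nonneg a2 a2) a2) e2) bl,
    mul_nonneg (mul_nonneg a1 e4) bl,
    mul_nonneg (mul_nonneg (mul_nonneg (mul_nonneg a1 e3) e4) bl) s1,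
    mul_nonneg (mul_nonneg a1 e2) bl,
    mul_nonneg (mul_nonneg (mul_nonneg a1 e2) e4) s1,
    mul_nonneg (mul_nonneg (mul_nonneg a1 e2) e3) s1,
    mul_nonneg (mul_nonneg (mul_nonneg a1 e2) e3) e4,
    mul_nonneg (mul_nonneg (mul_nonneg a1 e2) e2) bl,
    mul_nonneg (mul_nonneg a1 e1) e4,
    mul_nonneg (mul_nonneg a1 e1) e3,
    mul_nonneg (mul_nonneg a1 e1) e2,
    mul_nonneg (mul_nonneg (mul_nonneg a1 a4) e3) e3,
    mul_nonneg (mul_nonneg (mul_nonneg (mul_nonneg a1 a4) e3) e3) bl,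
    mul_nonneg (mul_nonneg (mul_nonneg a1 a4) e2) bl,
    mul_nonneg (mul_nonneg (mul_nonneg (mul_nonneg a1 a4) e2) e3) s1,
    mul_nonneg (mul_nonneg (mul_nonneg a1 a4) e2) e2,
    mul_nonneg (mul_nonneg (mul_nonneg (mul_nonneg a1 a4) e2) e2) bl,
    mul_nonneg (mul_nonneg (mul_nonneg a1 a3) e4) bl,
    mul_nonneg (mul_nonneg (mul_nonneg a1 a3) e4) e4,
    mul_nonneg (mul_nonneg (mul_nonneg (mul_nonneg a1 a3) e4) e4) bl,
    mul_nonneg (mul_nonneg (mul_nonneg a1 a3) e2) bl,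
    mul_nonneg (mul_nonneg (mul_nonneg a1 a3) e2) e2,
    mul_nonneg (mul_nonneg (mul_nonneg (mul_nonneg a1 a3) e2) e2) bl,
    mul_nonneg (mul_nonneg (mul_nonneg (mul_nonneg a1 a3) a4) e2) bl,
    mul_nonneg (mul_nonneg (mul_nonneg (mul_nonneg a1 a3) a4) e2) e2,
    mul_nonneg (mul_nonneg (mul_nonneg a1 a2) e4) e4,
    mul_nonneg (mul_nonneg (mul_nonneg (mul_nonneg a1 a2) e4) e4) bl,
    mul_nonneg (mul_nonneg (mul_nonneg a1 a2) e3) bl,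
    mul_nonneg (mul_nonneg (mul_nonneg (mul_nonneg a1 a2) e3) e4) s1,
    mul_nonneg (mul_nonneg (mul_nonneg a1 a2) e3) e3,
    mul_nonneg (mul_nonneg (mul_nonneg (mul_nonneg a1 a2) e3) e3) bl,
    mul_nonneg (mul_nonneg (mul_nonneg (mul_nonneg a1 a2) a4) e3) bl,
    mul_nonneg (mul_nonneg (mul_nonneg (mul_nonneg a1 a2) a4) e3) e3,
    mul_nonneg (mul_nonneg (mul_nonneg (mul_nonneg a1 a2) a3) e4) bl,
    mul_nonneg (mul_nonneg (mul_nonneg (mul_nonneg a1 a2) a3) e4) e4,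
    mul_nonneg (mul_nonneg (mul_nonneg (mul_nonneg a1 a1) a1) e1) bl]

end LawDec
end Quant
end Summit.CriticalPhenomena.PercolationContinuityZ3.Theorems
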